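import Summits.AtomisticToContinuum.HydrodynamicLimit.Theorems.OneFlightGossipEngineClampedTransferDockCubicChannelRate
import Summits.AtomisticToContinuum.HydrodynamicLimit.Theorems.OneFlightGossipEngineSuperExponentialEnergyTailsDefs
import HarnessLib

/-!
# Stub T1 `stub_seetOfVelocityHierarchy` — the order after the level (line `Sketch`, crux
# `SuperExponentialEnergyTails`, stmt-AtomisticToContinuum-17701)

Registered stub `stub_seetOfVelocityHierarchy : VelocityMomentHierarchy → SuperExponentialEnergyTails` of the
lead's skeleton `Cruxes/SuperExponentialEnergyTails/Lines/Sketch.lean` (v1): the `k`-wise velocity moment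
hierarchy `E_{λ₀}[(N+1)⁻¹ ∑ᵢ (‖vᵢ(s)‖²)ᵏ] ≤ C Aᵏ k!` for `N ≥ N₀(k)` (landed def
`Theorems.SuperExponentialEnergyTailsLine.VelocityMomentHierarchy`, p144693) implies the super-exponential cubic
velocity tail bound of the crux, in the form of its landed byte-identical twin
`Theorems.ClampedTransferDockCubicRate.SuperExponentialEnergyTails`.

Proof ("choose the ORDER after the LEVEL"): same `σ₀`; at rate `c` put
`K₀ = max (max 1 C) (e² A (c + 5))`; for `K ≥ K₀` take the order `k = ⌊K² / (e² A)⌋₊ ≥ 2` and the threshold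
`N₀ := N₀(k)` of the hierarchy.  Pointwise `‖v‖³ 1{‖v‖ > K} ≤ K³ / K^{2k} · (‖v‖²)ᵏ` (`indicator_cube_le_pow`), so by
linearity of the lower integral the cubic tail is at most `K³/K^{2k} · C Aᵏ k!`, and
`K³/K^{2k} · C Aᵏ k! ≤ C K³ (A k / K²)ᵏ ≤ C K³ e^{-2k} ≤ e^{K} e^{3K} e^{2 - 2K²/(e²A)} ≤ e^{-cK}`
(`level_order_bookkeeping`: `k! ≤ kᵏ`, `A k ≤ K² e^{-2}`, `K²/(e²A) < k + 1`, `C ≤ K ≤ e^K`,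
`K²/(e²A) ≥ (c + 5) K`).  The slack `ε` of the crux is not used.

prover-line-stmt-AtomisticToContinuum-17701-0 (stub worker `stub_seetOfVelocityHierarchy`).
-/

noncomputable section

namespace Summit.AtomisticToContinuum.HydrodynamicLimit.Theorems.SuperExponentialEnergyTailsSeetOfHierarchy

open scoped BigOperators ENNReal
open MeasureTheory Set
open Literature.MathematicalPhysics.KineticTheory Literature.Analysis.FluidPDE
open Summit.AtomisticToContinuum.HydrodynamicLimit.Theorems.SuperExponentialEnergyTailsLine (VelocityMomentHierarchy)

/-! ## §1 The pointwise domination of the cubic tail by an even moment -/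

/-- **Cubic tail under an even moment**: for a level `K > 0` and an order `k ≥ 2`, pointwise
`‖v‖³ 1{‖v‖ > K} ≤ K³ / K^{2k} · (‖v‖²)ᵏ` (on `‖v‖ > K`, `K^{2k-3} ≤ ‖v‖^{2k-3}`). [folklore] -/
theorem indicator_cube_le_pow {K : ℝ} (hK : 0 < K) {k : ℕ} (hk : 2 ≤ k) (v : V3) :
    Set.indicator {w : V3 | K < ‖w‖} (fun w => ‖w‖ ^ 3) v ≤ K ^ 3 / K ^ (2 * k) * (‖v‖ ^ 2) ^ k := by
  by_cases hv : K < ‖v‖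
  · rw [Set.indicator_of_mem (show v ∈ {w : V3 | K < ‖w‖} from hv), div_mul_eq_mul_div,
      le_div_iff₀ (pow_pos hK _), ← pow_mul]
    obtain ⟨m, hm⟩ : ∃ m : ℕ, 2 * k = 3 + m := ⟨2 * k - 3, by omega⟩
    rw [hm, pow_add, pow_add]
    have h1 : K ^ m ≤ ‖v‖ ^ m := pow_le_pow_left₀ hK.le hv.le m
    have h2 : 0 ≤ ‖v‖ ^ 3 * K ^ 3 := by positivity
    calc ‖v‖ ^ 3 * (K ^ 3 * K ^ m) = (‖v‖ ^ 3 * K ^ 3) * K ^ m := by ring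
      _ ≤ (‖v‖ ^ 3 * K ^ 3) * ‖v‖ ^ m := mul_le_mul_of_nonneg_left h1 h2
      _ = K ^ 3 * (‖v‖ ^ 3 * ‖v‖ ^ m) := by ring
  · rw [Set.indicator_of_notMem (show v ∉ {w : V3 | K < ‖w‖} from hv)]
    positivity

/-! ## §2 The level/order bookkeeping -/

/-- **The order after the level, real bookkeeping**: for `A, c > 0`, `C ≥ 0`, `K ≥ max 1 C` and `K ≥ e² A (c + 5)`, with the
order `k = ⌊K² / (e² A)⌋₊`, `K³ / K^{2k} · (C Aᵏ k!) ≤ e^{-cK}` — from `k! ≤ kᵏ`, `A k ≤ K² e^{-2}`,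
`K²/(e²A) < k + 1`, `C ≤ K ≤ e^K`, `K³ ≤ e^{3K}` and `K²/(e²A) ≥ (c + 5) K`. [folklore] -/
theorem level_order_bookkeeping {A C c K : ℝ} (hA : 0 < A) (hC : 0 ≤ C) (hc : 0 < c) (h1 : 1 ≤ K)
    (hCK : C ≤ K) (hAK : Real.exp 2 * A * (c + 5) ≤ K) :
    K ^ 3 / K ^ (2 * ⌊K ^ 2 / (Real.exp 2 * A)⌋₊) *
        (C * A ^ ⌊K ^ 2 / (Real.exp 2 * A)⌋₊ * ((⌊K ^ 2 / (Real.exp 2 * A)⌋₊).factorial : ℝ)) ≤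
      Real.exp (-(c * K)) := by
  set k : ℕ := ⌊K ^ 2 / (Real.exp 2 * A)⌋₊ with hk
  have hK : 0 < K := one_pos.trans_le h1
  have hEA : 0 < Real.exp 2 * A := mul_pos (Real.exp_pos 2) hA
  have hq0 : 0 ≤ K ^ 2 / (Real.exp 2 * A) := div_nonneg (sq_nonneg K) hEA.le
  have hkq : (k : ℝ) ≤ K ^ 2 / (Real.exp 2 * A) := Nat.floor_le hq0
  have hqk : K ^ 2 / (Real.exp 2 * A) < k + 1 := Nat.lt_floor_add_one _
  -- the order is at least `(c + 5) K - 1`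
  have hqK : (c + 5) * K ≤ K ^ 2 / (Real.exp 2 * A) := by
    rw [le_div_iff₀ hEA]
    calc (c + 5) * K * (Real.exp 2 * A) = Real.exp 2 * A * (c + 5) * K := by ring
      _ ≤ K * K := mul_le_mul_of_nonneg_right hAK hK.le
      _ = K ^ 2 := (sq K).symm
  -- `k! ≤ kᵏ`
  have hfac : (k.factorial : ℝ) ≤ (k : ℝ) ^ k := by exact_mod_cast Nat.factorial_le_pow k
  -- `A k ≤ K² e^{-2}`
  have hAk : A * k ≤ K ^ 2 * Real.exp (-2) := by
    have hAq : A * (K ^ 2 / (Real.exp 2 * A)) = K ^ 2 * Real.exp (-2) := by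
      rw [Real.exp_neg]
      field_simp
    calc A * k ≤ A * (K ^ 2 / (Real.exp 2 * A)) := mul_le_mul_of_nonneg_left hkq hA.le
      _ = K ^ 2 * Real.exp (-2) := hAq
  have hAkpow : (A * k) ^ k ≤ (K ^ 2) ^ k * Real.exp (-2) ^ k := by
    rw [← mul_pow]
    exact pow_le_pow_left₀ (by positivity) hAk k
  -- `C K³ e^{-2k} ≤ e^{-cK}`
  have hkey : C * K ^ 3 * Real.exp (-2) ^ k ≤ Real.exp (-(c * K)) := by
    have hKexp : K ≤ Real.exp K := by linarith [Real.add_one_le_exp K]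
    have hCexp : C ≤ Real.exp K := hCK.trans hKexp
    have hK3 : K ^ 3 ≤ Real.exp (3 * K) := by
      calc K ^ 3 ≤ Real.exp K ^ 3 := pow_le_pow_left₀ hK.le hKexp 3
        _ = Real.exp (3 * K) := by rw [← Real.exp_nat_mul]; norm_num
    have hE2k : Real.exp (-2) ^ k ≤ Real.exp (2 - 2 * (K ^ 2 / (Real.exp 2 * A))) := by
      rw [← Real.exp_nat_mul]
      exact Real.exp_le_exp.2 (by linarith)
    have hcK : 0 ≤ c * K := by positivity
    calc C * K ^ 3 * Real.exp (-2) ^ k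
        ≤ Real.exp K * Real.exp (3 * K) * Real.exp (2 - 2 * (K ^ 2 / (Real.exp 2 * A))) := by
          have h3 : 0 ≤ Real.exp (-2) ^ k := by positivity
          have hCK3 : C * K ^ 3 ≤ Real.exp K * Real.exp (3 * K) :=
            calc C * K ^ 3 ≤ Real.exp K * K ^ 3 := mul_le_mul_of_nonneg_right hCexp (by positivity)
              _ ≤ Real.exp K * Real.exp (3 * K) := mul_le_mul_of_nonneg_left hK3 (Real.exp_pos K).le
          exact mul_le_mul hCK3 hE2k h3 (by positivity)
      _ = Real.exp (K + 3 * K + (2 - 2 * (K ^ 2 / (Real.exp 2 * A)))) := by rw [Real.exp_add, Real.exp_add]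
      _ ≤ Real.exp (-(c * K)) := Real.exp_le_exp.2 (by nlinarith)
  -- assemble
  rw [div_mul_eq_mul_div, div_le_iff₀ (pow_pos hK _)]
  calc K ^ 3 * (C * A ^ k * (k.factorial : ℝ))
      ≤ K ^ 3 * (C * A ^ k * (k : ℝ) ^ k) := by gcongr
    _ = C * K ^ 3 * (A * k) ^ k := by rw [mul_pow]; ring
    _ ≤ C * K ^ 3 * ((K ^ 2) ^ k * Real.exp (-2) ^ k) :=
        mul_le_mul_of_nonneg_left hAkpow (by positivity)
    _ = C * K ^ 3 * Real.exp (-2) ^ k * K ^ (2 * k) := by rw [pow_mul]; ring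
    _ ≤ Real.exp (-(c * K)) * K ^ (2 * k) := mul_le_mul_of_nonneg_right hkey (by positivity)

/-! ## §3 The stub -/

/-- **Stub T1 — order after level** (registered stub `stub_seetOfVelocityHierarchy` of line Sketch, crux
SuperExponentialEnergyTails, stmt-AtomisticToContinuum-17701).  `VelocityMomentHierarchy → SEET`: same `σ₀`; at rate
`c` take `K₀ = max (max 1 C) (e² A (c + 5))`; for `K ≥ K₀` take the order `k = ⌊K²/(e²A)⌋₊ (≥ 2)` and
`N₀ := N₀(k)`; pointwise `‖v‖³ 1{‖v‖ > K} ≤ K³/K^{2k} (‖v‖²)ᵏ`, so the cubic tail is at most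
`K³/K^{2k} · C Aᵏ k! ≤ e^{-cK}`; the slack `ε` is unused.  The conclusion is the LANDED byte-identical twin
`Theorems.ClampedTransferDockCubicRate.SuperExponentialEnergyTails` of the route decl. -/
theorem stub_seetOfVelocityHierarchy :
    VelocityMomentHierarchy →
      Summit.AtomisticToContinuum.HydrodynamicLimit.Theorems.ClampedTransferDockCubicRate.SuperExponentialEnergyTails := by
  intro h a₀ θ₀ u₀ ha hθ hu ha0 hθ0
  obtain ⟨σ₀, hσ₀, H⟩ := h a₀ θ₀ u₀ ha hθ hu ha0 hθ0
  refine ⟨σ₀, hσ₀, fun σ hσ hσlt T ρ θ u hE Φ htie t ht c hc => ?_⟩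
  obtain ⟨A, hA, C, hC, HK⟩ := H σ hσ hσlt T ρ θ u hE Φ htie t ht
  refine ⟨max (max 1 C) (Real.exp 2 * A * (c + 5)),
    lt_of_lt_of_le one_pos ((le_max_left _ _).trans (le_max_left _ _)), fun K hK ε hε => ?_⟩
  have h1 : 1 ≤ K := ((le_max_left _ _).trans (le_max_left _ _)).trans hK
  have hCK : C ≤ K := ((le_max_right _ _).trans (le_max_left _ _)).trans hK
  have hAK : Real.exp 2 * A * (c + 5) ≤ K := (le_max_right _ _).trans hK
  have hKpos : 0 < K := one_pos.trans_le h1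
  have hEA : 0 < Real.exp 2 * A := mul_pos (Real.exp_pos 2) hA
  -- the order after the level
  set k : ℕ := ⌊K ^ 2 / (Real.exp 2 * A)⌋₊ with hk
  have hk2 : 2 ≤ k := by
    rw [hk, Nat.le_floor_iff (div_nonneg (sq_nonneg K) hEA.le), le_div_iff₀ hEA]
    push_cast
    have h5 : 5 * (Real.exp 2 * A) ≤ K := by nlinarith [hEA.le, hc.le]
    nlinarith [hEA.le, hKpos.le]
  obtain ⟨N₀, HN⟩ := HK k
  refine ⟨N₀, fun N hN s hs => ?_⟩
  -- the constant and the real bookkeeping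
  set M : ℝ := K ^ 3 / K ^ (2 * k) with hM
  have hM0 : 0 ≤ M := by positivity
  have hreal : M * (C * A ^ k * (k.factorial : ℝ)) ≤ Real.exp (-(c * K)) :=
    level_order_bookkeeping hA hC.le hc h1 hCK hAK
  -- pointwise domination of the integrand
  have hpt : ∀ z : Config (N + 1) (Fin 3) T3,
      ENNReal.ofReal (((N : ℝ) + 1)⁻¹ * ∑ i : Fin (N + 1),
        Set.indicator {v : V3 | K < ‖v‖} (fun v => ‖v‖ ^ 3) (((Φ N).flow s z i).2)) ≤
      ENNReal.ofReal M * ENNReal.ofReal (((N : ℝ) + 1)⁻¹ * ∑ i : Fin (N + 1),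
        (‖((Φ N).flow s z i).2‖ ^ 2) ^ k) := by
    intro z
    rw [← ENNReal.ofReal_mul hM0]
    refine ENNReal.ofReal_le_ofReal ?_
    calc ((N : ℝ) + 1)⁻¹ * ∑ i : Fin (N + 1),
          Set.indicator {v : V3 | K < ‖v‖} (fun v => ‖v‖ ^ 3) (((Φ N).flow s z i).2)
        ≤ ((N : ℝ) + 1)⁻¹ * ∑ i : Fin (N + 1), M * (‖((Φ N).flow s z i).2‖ ^ 2) ^ k :=
          mul_le_mul_of_nonneg_left (Finset.sum_le_sum fun i _ => indicator_cube_le_pow hKpos hk2 _)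
            (by positivity)
      _ = M * (((N : ℝ) + 1)⁻¹ * ∑ i : Fin (N + 1), (‖((Φ N).flow s z i).2‖ ^ 2) ^ k) := by
          rw [← Finset.mul_sum]
          ring
  -- linearity of the lower integral and the hierarchy at order `k`
  calc ∫⁻ z, ENNReal.ofReal (((N : ℝ) + 1)⁻¹ * ∑ i : Fin (N + 1),
          Set.indicator {v : V3 | K < ‖v‖} (fun v => ‖v‖ ^ 3) (((Φ N).flow s z i).2))
          ∂(localGibbsLaw σ a₀ u₀ θ₀ N (Φ N))
      ≤ ∫⁻ z, ENNReal.ofReal M * ENNReal.ofReal (((N : ℝ) + 1)⁻¹ * ∑ i : Fin (N + 1),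
          (‖((Φ N).flow s z i).2‖ ^ 2) ^ k) ∂(localGibbsLaw σ a₀ u₀ θ₀ N (Φ N)) := lintegral_mono (hpt ·)
    _ = ENNReal.ofReal M * ∫⁻ z, ENNReal.ofReal (((N : ℝ) + 1)⁻¹ * ∑ i : Fin (N + 1),
          (‖((Φ N).flow s z i).2‖ ^ 2) ^ k) ∂(localGibbsLaw σ a₀ u₀ θ₀ N (Φ N)) :=
        lintegral_const_mul' _ _ ENNReal.ofReal_ne_top
    _ ≤ ENNReal.ofReal M * ENNReal.ofReal (C * A ^ k * (k.factorial : ℝ)) := mul_le_mul' le_rfl (HN N hN s hs)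
    _ = ENNReal.ofReal (M * (C * A ^ k * (k.factorial : ℝ))) := (ENNReal.ofReal_mul hM0).symm
    _ ≤ ENNReal.ofReal (Real.exp (-(c * K))) := ENNReal.ofReal_le_ofReal hreal
    _ ≤ ENNReal.ofReal (Real.exp (-(c * K)) + ε) := ENNReal.ofReal_le_ofReal (by linarith)

end Summit.AtomisticToContinuum.HydrodynamicLimit.Theorems.SuperExponentialEnergyTailsSeetOfHierarchy

end
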